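import Summits.NavierStokesRegularity.NavierStokesRegularity.Theorems.ScenarioCensusSelfSimilarCone
import Summits.NavierStokesRegularity.NavierStokesRegularity.Theorems.DssFarFieldSlavingBlowupTypeIDssProfileSimilarityEnstrophyCrossFlowThreshold
import Summits.NavierStokesRegularity.NavierStokesRegularity.Theorems.DssFarFieldSlavingBlowupTypeIDssProfileSimilarityEnstrophyLambThreshold
import Summits.NavierStokesRegularity.NavierStokesRegularity.Theorems.DssFarFieldSlavingBlowupTypeIDssProfileSimilarityEnstrophyUnconditional
import Summits.NavierStokesRegularity.NavierStokesRegularity.Theorems.DssFarFieldSlavingBlowupTypeIDssProfileStrainBudget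
import Summits.NavierStokesRegularity.NavierStokesRegularity.Theorems.DssFarFieldSlavingBlowupTypeIDssProfileCertificateThreshold
import Summits.NavierStokesRegularity.NavierStokesRegularity.Theorems.DssFarFieldSlavingBlowupTypeIDssProfileLambCurlMaximumPrinciple
import Summits.NavierStokesRegularity.NavierStokesRegularity.Theorems.DssFarFieldSlavingBlowupTypeIDssProfileGaussianGapClass
import Summits.NavierStokesRegularity.NavierStokesRegularity.Theorems.DssFarFieldSlavingBlowupTypeIDssProfileGaussianSignCoherentClass
import HarnessLib.Audit
import HarnessLib

/-!
# Blow-up scenario census — block D, row D7c: the ANALYTIC side conditions on the rotated-DSS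
# Type-I profile class (second cone annex; `DssFarFieldSlaving` cone)

Companion of `ScenarioCensusSelfSimilarCone.lean` (which names the class `RdssClassEmpty M` /
`RdssClassEmptyUnder M P` and types rows D6, D7c-symmetry, D7d), split off for the 400-line cap.
Each row: the sub-class of the census's `rdssClass M` cut out by an ANALYTIC side condition imposed
on every smooth Type-I representative `V` of the member (`IsTypeIAncientMild M V`, `V = u` a.e.) is
EMPTY — the statement of the named tree closer, which is UNCONDITIONAL (the conditional twins
`ExplicitThreshold.*` / `…hardyStretching_empty` are not exclusions, refuter H3).  All these closers are
«DSS-blind» (the rotated-DSS conjunct is carried, not used): they are really Liouville theorems for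
Type-I ancient mild solutions under the side condition (cf. census block A).

| key | side condition | closer (`STH.` = `…Theorems.`) |
|---|---|---|
| D7cX | cross-flow `√(−t)‖ω × V‖ ≤ θ‖ω‖`, `θ < 1` | `SimilarityEnstrophy.rdssClass_empty_of_crossFlow` |
| D7cLD | Lamb direction `√(−t)|⟪V, ω × curl ω⟫| ≤ θ‖ω × curl ω‖`, `θ < 1` | `SimilarityEnstrophy.rdssClass_empty_of_lambDirection` |
| D7cH | Hardy stretching `‖x−x₀‖²⟪∇V ω, ω⟫ ≤ ¼‖ω‖²` | `SimilarityEnstrophy.rdssClass_hardyStretching_empty_unconditional` |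
| D7cSB | strain budget `⟪∇V ξ,ξ⟩ ≤ ((1−δ)/(−t) + g′(t))‖ξ‖²` | `SubcriticalStrain.rdssClass_strainBudget_empty` |
| D7cC | subcritical certificate `(−t)(⟪∇V ξ̂,ξ̂⟫ − |∇ξ̂|²) ≤ Λ < 1` on `{ω ≠ 0}` | `CertificateThreshold.rdssClass_subcriticalCertificate_empty` |
| D7cCL | curl-Lamb defect `(−t)‖curl(ω × V)‖ ≤ θ‖ω‖`, `θ < 1` | `LambCurlBound.rdssClass_empty_of_curlLambDefect` |
| D7cGG | Gaussian gap budget `Λ + Pm/4 + μ₀/2 < 3/2` in similarity variables | `GaussianGap.rdssClass_gaussianGap_empty` |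

**Nothing here is a claim about Navier–Stokes regularity; no summit statement is proved by this seat.**
-/

noncomputable section

-- the summit and its single problem share the name `NavierStokesRegularity` (D-0017 nested layout)
set_option linter.dupNamespace false

open Set Function Filter Topology MeasureTheory
open scoped RealInnerProductSpace

namespace Summit.NavierStokesRegularity.NavierStokesRegularity.Theorems.ScenarioCensus

open Literature.Analysis Literature.Analysis.FluidPDE
open Summit.NavierStokesRegularity.NavierStokesRegularity.Theorems

/-- **Row D7cX** (CROSS-FLOW threshold: representatives with `√(−t) ‖ω × V‖ ≤ θ ‖ω‖`, `θ < 1`):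
empty (`SimilarityEnstrophy.rdssClass_empty_of_crossFlow`).  EXCLUDED-IN-TREE. (ref: tree) -/
def Row_D7cX : Prop :=
  ∀ M θ : ℝ, θ < 1 → RdssClassEmptyUnder M fun u =>
    ∀ V : ℝ → EuclideanSpace ℝ (Fin 3) → EuclideanSpace ℝ (Fin 3), IsTypeIAncientMild M V →
      (∀ t < 0, V t =ᵐ[volume] u t) →
      ∀ t < 0, ∀ x, Real.sqrt (-t) * ‖cross (curl (V t) x) (V t x)‖ ≤ θ * ‖curl (V t) x‖

/-- Row D7cX is a theorem of the tree. [folklore] -/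
theorem row_D7cX_excluded : Row_D7cX := fun M _ hθ => SimilarityEnstrophy.rdssClass_empty_of_crossFlow M hθ

/-- **Row D7cLD** (LAMB-DIRECTION threshold: `√(−t) |⟪V, ω × curl ω⟫| ≤ θ ‖ω × curl ω‖`, `θ < 1`):
empty (`SimilarityEnstrophy.rdssClass_empty_of_lambDirection`).  EXCLUDED-IN-TREE. (ref: tree) -/
def Row_D7cLD : Prop :=
  ∀ M θ : ℝ, θ < 1 → RdssClassEmptyUnder M fun u =>
    ∀ V : ℝ → EuclideanSpace ℝ (Fin 3) → EuclideanSpace ℝ (Fin 3), IsTypeIAncientMild M V →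
      (∀ t < 0, V t =ᵐ[volume] u t) →
      ∀ t < 0, ∀ x,
      Real.sqrt (-t) * |⟪V t x, cross (curl (V t) x) (curl (curl (V t)) x)⟫| ≤
        θ * ‖cross (curl (V t) x) (curl (curl (V t)) x)‖

/-- Row D7cLD is a theorem of the tree. [folklore] -/
theorem row_D7cLD_excluded : Row_D7cLD := fun M _ hθ => SimilarityEnstrophy.rdssClass_empty_of_lambDirection M hθ

/-- **Row D7cH** (HARDY-weighted stretching about some centre: `‖x−x₀‖² ⟪∇V ω, ω⟫ ≤ ¼‖ω‖²`):
empty, UNCONDITIONALLY (`SimilarityEnstrophy.rdssClass_hardyStretching_empty_unconditional`; the short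
name `…hardyStretching_empty` is the conditional twin).  EXCLUDED-IN-TREE. (ref: tree) -/
def Row_D7cH : Prop :=
  ∀ M : ℝ, RdssClassEmptyUnder M fun u =>
    ∀ V : ℝ → EuclideanSpace ℝ (Fin 3) → EuclideanSpace ℝ (Fin 3), IsTypeIAncientMild M V →
      (∀ t < 0, V t =ᵐ[volume] u t) →
      ∃ x₀ : EuclideanSpace ℝ (Fin 3), ∀ t < 0, ∀ x,
      ‖x - x₀‖ ^ 2 * ⟪fderiv ℝ (V t) x (curl (V t) x), curl (V t) x⟫ ≤ (1 / 4) * ‖curl (V t) x‖ ^ 2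

/-- Row D7cH is a theorem of the tree. [folklore] -/
theorem row_D7cH_excluded : Row_D7cH := fun M =>
  SimilarityEnstrophy.rdssClass_hardyStretching_empty_unconditional M

/-- **Row D7cSB** (STRAIN BUDGET: `⟪∇V ξ, ξ⟫ ≤ ((1−δ)/(−t) + g'(t)) ‖ξ‖²` for a smooth `g ≥ 0` on
`(−∞,0)`, `δ > 0`): empty (`SubcriticalStrain.rdssClass_strainBudget_empty`).  EXCLUDED-IN-TREE. (ref: tree) -/
def Row_D7cSB : Prop :=
  ∀ (M δ : ℝ), 0 < δ → ∀ (g : ℝ → ℝ), ContDiffOn ℝ (⊤ : ℕ∞) g (Iio 0) → (∀ t < 0, 0 ≤ g t) →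
    RdssClassEmptyUnder M fun u =>
      ∀ V : ℝ → EuclideanSpace ℝ (Fin 3) → EuclideanSpace ℝ (Fin 3), IsTypeIAncientMild M V →
      (∀ t < 0, V t =ᵐ[volume] u t) →
      ∀ t < 0, ∀ x ξ : EuclideanSpace ℝ (Fin 3),
        ⟪fderiv ℝ (V t) x ξ, ξ⟫ ≤ ((1 - δ) / (-t) + deriv g t) * ‖ξ‖ ^ 2

/-- Row D7cSB is a theorem of the tree. [folklore] -/
theorem row_D7cSB_excluded : Row_D7cSB := fun M _ hδ _ hg hg0 =>
  SubcriticalStrain.rdssClass_strainBudget_empty M hδ hg hg0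

/-- **Row D7cC** (subcritical CERTIFICATE: `(−t)(⟪∇V ξ̂, ξ̂⟫ − |∇ξ̂|²_F) ≤ Λ < 1` wherever `ω ≠ 0`):
empty (`CertificateThreshold.rdssClass_subcriticalCertificate_empty`).  EXCLUDED-IN-TREE. (ref: tree) -/
def Row_D7cC : Prop :=
  ∀ M Λ : ℝ, Λ < 1 → RdssClassEmptyUnder M fun u =>
    ∀ V : ℝ → EuclideanSpace ℝ (Fin 3) → EuclideanSpace ℝ (Fin 3), IsTypeIAncientMild M V →
      (∀ t < 0, V t =ᵐ[volume] u t) →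
      ∀ t < 0, ∀ x : EuclideanSpace ℝ (Fin 3), curl (V t) x ≠ 0 →
      (-t) * (⟪fderiv ℝ (V t) x (vorticityDirection (curl (V t)) x),
          vorticityDirection (curl (V t)) x⟫
        - frobeniusNormSq (fderiv ℝ (vorticityDirection (curl (V t))) x)) ≤ Λ

/-- Row D7cC is a theorem of the tree. [folklore] -/
theorem row_D7cC_excluded : Row_D7cC := fun M _ hΛ =>
  CertificateThreshold.rdssClass_subcriticalCertificate_empty M hΛ

/-- **Row D7cCL** (CURL-LAMB defect: `(−t) ‖curl(ω × V)‖ ≤ θ ‖ω‖`, `θ < 1`): empty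
(`LambCurlBound.rdssClass_empty_of_curlLambDefect`).  EXCLUDED-IN-TREE. (ref: tree) -/
def Row_D7cCL : Prop :=
  ∀ M θ : ℝ, θ < 1 → RdssClassEmptyUnder M fun u =>
    ∀ V : ℝ → EuclideanSpace ℝ (Fin 3) → EuclideanSpace ℝ (Fin 3), IsTypeIAncientMild M V →
      (∀ t < 0, V t =ᵐ[volume] u t) →
      ∀ t < 0, ∀ x,
      (-t) * ‖curl (fun z => cross (curl (V t) z) (V t z)) x‖ ≤ θ * ‖curl (V t) x‖

/-- Row D7cCL is a theorem of the tree. [folklore] -/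
theorem row_D7cCL_excluded : Row_D7cCL := fun M _ hθ => LambCurlBound.rdssClass_empty_of_curlLambDefect M hθ

/-- **Row D7cGG** (GAUSSIAN GAP budget in similarity variables: stretching `≤ Λ‖Ω‖²` along the Leray
orbit, radial head `−⟪y, U⟫ ≤ Pm`, Gaussian mean of the vorticity `≤ μ₀`-fraction, with
`Λ + Pm/4 + μ₀/2 < 3/2`): empty (`GaussianGap.rdssClass_gaussianGap_empty`).  EXCLUDED-IN-TREE. (ref: tree) -/
def Row_D7cGG : Prop :=
  ∀ M Λ Pm μ₀ : ℝ, Λ + Pm / 4 + μ₀ / 2 < 3 / 2 → RdssClassEmptyUnder M fun u =>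
    ∀ V : ℝ → EuclideanSpace ℝ (Fin 3) → EuclideanSpace ℝ (Fin 3), IsTypeIAncientMild M V →
      (∀ t < 0, V t =ᵐ[volume] u t) →
      (∀ (s : ℝ) (y : EuclideanSpace ℝ (Fin 3)),
        ⟪fderiv ℝ (lerayOrbit V s) y (lerayVorticity V s y), lerayVorticity V s y⟫ ≤
          Λ * ‖lerayVorticity V s y‖ ^ 2) ∧
      (∀ (s : ℝ) (y : EuclideanSpace ℝ (Fin 3)), -⟪y, lerayOrbit V s y⟫ ≤ Pm) ∧
      (∀ s : ℝ,
        ‖∫ y, UnboundedOperators.heatKernel 1 y • lerayVorticity V s y‖ ^ 2 ≤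
          μ₀ * ∫ y, UnboundedOperators.heatKernel 1 y * ‖lerayVorticity V s y‖ ^ 2)

/-- Row D7cGG is a theorem of the tree. [folklore] -/
theorem row_D7cGG_excluded : Row_D7cGG := fun M _ _ _ h => GaussianGap.rdssClass_gaussianGap_empty M h

/-! ## Round 2 (appended 2026-08-28): the sign-coherent Gaussian head-pressure cells (twist about
`e₃` by `rotZLIE (−θ)`, class binder `(c, θ, u)` — verbatim, not through `RdssClassEmptyUnder`) -/

open Literature.Analysis.FluidPDE.PineauVicol2026 in
/-- **Row D7cSC** (SIGN-COHERENT Gaussian class: along the co-rotating Leray orbit of every smooth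
Type-I representative, the radial head `⟪y, U⟫ (½‖U‖² + e^{−s} P)` is pointwise `≥ 0`; twist
`rotZLIE (−θ)`, any factor, any `M`): empty — verbatim
`GaussianHeadPressure.rdssClass_signCoherent_empty`.  EXCLUDED-IN-TREE. (ref: tree route
DssFarFieldSlaving, Gaussian head-pressure identity) -/
def Row_D7cSC : Prop :=
  ∀ M : ℝ,
    ¬ ∃ (c θ : ℝ) (u : ℝ → EuclideanSpace ℝ (Fin 3) → EuclideanSpace ℝ (Fin 3)),
      1 < c ∧ IsAncientMildSolution 1 u ∧ (∀ t < 0, AEStronglyMeasurable (u t) volume) ∧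
      IsRotatedDSS c (rotZLIE (-θ)) u ∧ HasTypeIDecay M u ∧
      (∀ V : ℝ → EuclideanSpace ℝ (Fin 3) → EuclideanSpace ℝ (Fin 3), IsTypeIAncientMild M V →
        (∀ t < 0, V t =ᵐ[volume] u t) →
        ∀ (s : ℝ) (y : EuclideanSpace ℝ (Fin 3)),
          0 ≤ ⟪y, rotZ (-(θ / (2 * Real.log c) * s))
                (lerayOrbit V s (rotZ (θ / (2 * Real.log c) * s) y))⟫ *
            (2⁻¹ * ‖rotZ (-(θ / (2 * Real.log c) * s))
                (lerayOrbit V s (rotZ (θ / (2 * Real.log c) * s) y))‖ ^ 2 +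
              Real.exp (-s) * pressurePotential (V (-Real.exp (-s)))
                (Real.exp (-s / 2) • rotZ (θ / (2 * Real.log c) * s) y))) ∧
      ¬ (∀ t < 0, u t =ᵐ[volume] 0)

/-- Row D7cSC is a theorem of the tree. [folklore] -/
theorem row_D7cSC_excluded : Row_D7cSC := fun M => GaussianHeadPressure.rdssClass_signCoherent_empty M

open Literature.Analysis.FluidPDE.PineauVicol2026 in
/-- **Row D7cMSC** (MEAN sign-coherent Gaussian class: the same head quantity, plus `½⟪y, U⟫`, has
nonnegative Gaussian space–time mean over one period `s ∈ (0, 2 log c)`): empty — verbatim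
`GaussianHeadPressure.rdssClass_meanSignCoherent_empty`.  EXCLUDED-IN-TREE. (ref: tree) -/
def Row_D7cMSC : Prop :=
  ∀ M : ℝ,
    ¬ ∃ (c θ : ℝ) (u : ℝ → EuclideanSpace ℝ (Fin 3) → EuclideanSpace ℝ (Fin 3)),
      1 < c ∧ IsAncientMildSolution 1 u ∧ (∀ t < 0, AEStronglyMeasurable (u t) volume) ∧
      IsRotatedDSS c (rotZLIE (-θ)) u ∧ HasTypeIDecay M u ∧
      (∀ V : ℝ → EuclideanSpace ℝ (Fin 3) → EuclideanSpace ℝ (Fin 3), IsTypeIAncientMild M V →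
        (∀ t < 0, V t =ᵐ[volume] u t) →
        0 ≤ ∫ s in (0 : ℝ)..(2 * Real.log c), ∫ y : EuclideanSpace ℝ (Fin 3), gaussWeight y *
          (⟪y, rotZ (-(θ / (2 * Real.log c) * s))
                (lerayOrbit V s (rotZ (θ / (2 * Real.log c) * s) y))⟫ *
            (2⁻¹ * ‖rotZ (-(θ / (2 * Real.log c) * s))
                (lerayOrbit V s (rotZ (θ / (2 * Real.log c) * s) y))‖ ^ 2 +
              Real.exp (-s) * pressurePotential (V (-Real.exp (-s)))
                (Real.exp (-s / 2) • rotZ (θ / (2 * Real.log c) * s) y) +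
              1 / 2 * ⟪y, rotZ (-(θ / (2 * Real.log c) * s))
                (lerayOrbit V s (rotZ (θ / (2 * Real.log c) * s) y))⟫))) ∧
      ¬ (∀ t < 0, u t =ᵐ[volume] 0)

/-- Row D7cMSC is a theorem of the tree. [folklore] -/
theorem row_D7cMSC_excluded : Row_D7cMSC := fun M =>
  GaussianHeadPressure.rdssClass_meanSignCoherent_empty M

/-! ## Appended 2026-08-28 (typer-1 g4, lead g4 ORDER 09:54Z [2/2]): the no-symmetry ANCHOR `A ≤ 1/2`
## of the window family A9i / A9i′ (rows typed cone-free in `ScenarioCensusAncientAnnex.lean`)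

The window rows A9i (`A ≤ 5/2`) / A9i′ (`A ≤ 3/2`) of the census ask whether an irreducible finite
symmetry widens the space window under which a KNSS-gauge Type-I ancient mild field must vanish.  The
ANCHOR of the family — the window `A ≤ 1/2` with NO symmetry used — is a theorem of the tree in this cone:
`SimilarityEnstrophy.typeI_ancient_eq_zero_of_spaceConstant_le_half`
(`…SimilarityEnstrophySpaceThreshold.lean:314`, Hardy's constant `4`).  Typed here with the same binders as
`Row_A9i` (the symmetry hypothesis is carried, not used), so that the lattice reads
A9iHalf (EXCLUDED) ⊂ A9i′ ⊂ A9i (OPEN). -/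

/-- **Row A9iHalf** (the anchor `A ≤ 1/2` of the A9i window family: KNSS-gauge Type I, any `M` · space
window `‖x‖‖V(t,x)‖ ≤ A ≤ 1/2` · slices equivariant under a set `G` of linear isometries — `G` and its
irreducibility are carried, NOT used): `V ≡ 0` on `t < 0`.  EXCLUDED-IN-TREE by
`SimilarityEnstrophy.typeI_ancient_eq_zero_of_spaceConstant_le_half` (similarity enstrophy + Hardy).
(ref: tree, route DssFarFieldSlaving cone; census rows A9i/A9i′ in `ScenarioCensusAncientAnnex.lean`) -/
def Row_A9iHalf : Prop :=
  ∀ (M A : ℝ) (G : Set (EuclideanSpace ℝ (Fin 3) ≃ₗᵢ[ℝ] EuclideanSpace ℝ (Fin 3))),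
    (∀ v : EuclideanSpace ℝ (Fin 3), (∀ g ∈ G, g v = v ∨ g v = -v) → v = 0) → A ≤ 1 / 2 →
    ∀ V : ℝ → EuclideanSpace ℝ (Fin 3) → EuclideanSpace ℝ (Fin 3), IsTypeIAncientMild M V →
      (∀ t < 0, ∀ x, ‖x‖ * ‖V t x‖ ≤ A) →
      (∀ g ∈ G, ∀ t < 0, ∀ x, V t (g x) = g (V t x)) →
        ∀ t < 0, ∀ x, V t x = 0

/-- Row A9iHalf is a theorem of the tree (the symmetry binders are unused):
`SimilarityEnstrophy.typeI_ancient_eq_zero_of_spaceConstant_le_half`. [cite: KochNadirashviliSereginSverak2009, §1 (arXiv:0709.3599)] -/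
theorem row_A9iHalf_excluded : Row_A9iHalf :=
  fun _ _ _ _ hA _ hV hAV _ => SimilarityEnstrophy.typeI_ancient_eq_zero_of_spaceConstant_le_half hV hAV hA

end Summit.NavierStokesRegularity.NavierStokesRegularity.Theorems.ScenarioCensus

end
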